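import Summits.ValiantsHypothesis.ValiantsHypothesis.Theorems.KPlusLogSqLawBandOneClasses

/-!
# Route «KPlusLogSqLaw» — the SUPPORT-RESTRICTED STATIC REDUCTION: `K` classes cost a factor `|support|·K + 1` over static designs

HONEST FRAMING.  Helper toward the crux `WeakLifting` (item `stmt-ValiantsHypothesis-19561`, route `KPlusLogSqLaw`, cell `pub-symmetroid`,
seat val-sym-lift-p3 g7, 2026-08-27) and the cell's tropical sector laws: a TOOL theorem extracted from `…BandOneClasses` (p535418), where it is
proved for the band support.  For ANY support predicate `Supp` on entries with at most `s` entries and any dominance design `(d, v, ε)` of format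
`(m, K)` whose present entries lie in `Supp`: **if every STATIC sub-design of `ε` (one class per entry, read off an arbitrary class table `cls`:
`ε_cls i j l = if l = cls i j then ε i j l else 0`, same `d`, `v`) has all its chains of distinct consecutive dominant terms of length `≤ L`, then
every such chain of `(d, v, ε)` itself has `n + 1 ≤ (s·K + 1)·(L + 1)`** (`StaticReduction.chain_succ_le`).  Proof as in `…BandOneClasses`: NO RETURN of
classes along the uses of an entry (`BandOneClasses.class_noReturn`, from `d_lt_of_isDominant_of_sameEntry`), first-occurrence indices inject into
`Supp × Fin K`, intervals free of first occurrences are static chains (`StaticReduction.interval_le`), and `k ↦ (last first-occurrence ≤ k, offset)`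
is injective.  Compare the tree's format-level static reduction `tropRootLawAt_of_static` (factor `m²(K−1)+1`, all supports): the point here is that a
static law proved for a SPARSE support class (band: `…StaticTridiagonalSupport`; future: cyclic band, Hessenberg, bandwidth `u`) yields the `K`-class
law for the same class with the factor `s·K + 1` of that class.  Nothing here asserts anything about `WeakLifting`, `TropicalB`, `KPlusLogSqLaw`,
`MatrixDescartes` (stmt-ValiantsHypothesis-18050) or `VP ≠ VNP`.
[folklore] (first-occurrence decomposition; bookkeeping).
-/

set_option linter.dupNamespace false
set_option autoImplicit false

namespace Summit.ValiantsHypothesis.ValiantsHypothesis.Theorems.KPlusLogSqLaw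

open Finset Classical
open Summit.ValiantsHypothesis.ValiantsHypothesis.Theorems.MatrixDescartes.Negative
open BandOneClasses (class_noReturn)

namespace StaticReduction

variable {m K : ℕ}

/-- **interval lemma (general support)**: if on the index interval `[a, a + len]` every entry is used with at most one class, and every static
sub-design of `ε` has chains of length `≤ L`, then `len ≤ L`. [folklore] -/
theorem interval_le (d : Fin K → ℕ) (v ε : Fin m → Fin m → Fin K → ℤ) (L : ℕ)
    (hstatic : ∀ (cls : Fin m → Fin m → Fin K) (n' : ℕ) (θ' : Fin (n' + 1) → ℤ)
      (p' : Fin (n' + 1) → Equiv.Perm (Fin m) × (Fin m → Fin K)), StrictMono θ' →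
      (∀ k, IsDominant d v (fun i j l => if l = cls i j then ε i j l else 0) (θ' k) (p' k)) →
      (∀ k : Fin n', p' k.castSucc ≠ p' k.succ) → n' ≤ L)
    {n : ℕ} (θ : Fin (n + 1) → ℤ) (p : Fin (n + 1) → Equiv.Perm (Fin m) × (Fin m → Fin K)) (hθ : StrictMono θ)
    (hdom : ∀ k, IsDominant d v ε (θ k) (p k)) (hne : ∀ k : Fin n, p k.castSucc ≠ p k.succ)
    (a len : ℕ) (h : a + len ≤ n)
    (hcons : ∀ k k' : Fin (n + 1), a ≤ k → (k : ℕ) ≤ a + len → a ≤ k' → (k' : ℕ) ≤ a + len →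
      ∀ j, (p k).1 j = (p k').1 j → (p k).2 j = (p k').2 j) :
    len ≤ L := by
  -- the class table of the interval
  let a0 : Fin (n + 1) := ⟨a, by omega⟩
  let cls : Fin m → Fin m → Fin K := fun i j =>
    if hu : ∃ k : Fin (n + 1), a ≤ k ∧ (k : ℕ) ≤ a + len ∧ (p k).1 j = i then (p (Classical.choose hu)).2 j else (p a0).2 j
  have hcls : ∀ k : Fin (n + 1), a ≤ k → (k : ℕ) ≤ a + len → ∀ j, cls ((p k).1 j) j = (p k).2 j := by
    intro k hk1 hk2 j
    have hu : ∃ k' : Fin (n + 1), a ≤ k' ∧ (k' : ℕ) ≤ a + len ∧ (p k').1 j = (p k).1 j := ⟨k, hk1, hk2, rfl⟩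
    simp only [cls, dif_pos hu]
    obtain ⟨h1, h2, h3⟩ := Classical.choose_spec hu
    exact hcons _ _ h1 h2 hk1 hk2 j h3
  -- the static design of the interval
  let εc : Fin m → Fin m → Fin K → ℤ := fun i j l => if l = cls i j then ε i j l else 0
  -- sign of terms: a term present for `εc` is present for `ε` with the same sign; chain terms are present for `εc`
  have hsign_c : ∀ q : Equiv.Perm (Fin m) × (Fin m → Fin K), termSign εc q ≠ 0 → termSign εc q = termSign ε q := by
    intro q hq
    unfold termSign at hq ⊢
    have hprod : ∏ i, εc (q.1 i) i (q.2 i) ≠ 0 := fun h0 => hq (by rw [h0, mul_zero])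
    rw [prod_ne_zero_iff] at hprod
    congr 1
    refine prod_congr rfl fun i _ => ?_
    have hi := hprod i (mem_univ i)
    simp only [εc] at hi ⊢
    split_ifs at hi ⊢ with h1
    · rfl
    · exact absurd rfl hi
  have hsign_p : ∀ k : Fin (n + 1), a ≤ k → (k : ℕ) ≤ a + len → termSign εc (p k) = termSign ε (p k) := by
    intro k hk1 hk2
    unfold termSign
    congr 1
    refine prod_congr rfl fun i _ => ?_
    simp only [εc, if_pos (hcls k hk1 hk2 i).symm]
  -- the shifted chain
  let θ' : Fin (len + 1) → ℤ := fun k => θ ⟨a + k, by omega⟩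
  let p' : Fin (len + 1) → Equiv.Perm (Fin m) × (Fin m → Fin K) := fun k => p ⟨a + k, by omega⟩
  have hθ' : StrictMono θ' := fun x y hxy => hθ (by simp only [Fin.lt_def]; omega)
  have hdom' : ∀ k, IsDominant d v εc (θ' k) (p' k) := by
    intro k
    have hk1 : a ≤ (⟨a + k, by omega⟩ : Fin (n + 1)) := by simp
    have hk2 : ((⟨a + k, by omega⟩ : Fin (n + 1)) : ℕ) ≤ a + len := by simp; omega
    refine ⟨?_, fun q hq hqs => ?_⟩
    · show termSign εc (p ⟨a + k, _⟩) ≠ 0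
      rw [hsign_p _ hk1 hk2]; exact (hdom _).1
    · have hqs' : termSign ε q ≠ 0 := by rw [← hsign_c q hqs]; exact hqs
      exact (hdom _).2 q hq hqs'
  have hne' : ∀ k : Fin len, p' k.castSucc ≠ p' k.succ := by
    intro k heq
    have := hne ⟨a + k, by omega⟩
    apply this
    simp only [p'] at heq
    have e1 : (⟨a + k, by omega⟩ : Fin n).castSucc = ⟨a + (k.castSucc : ℕ), by simp; omega⟩ := Fin.ext (by simp)
    have e2 : (⟨a + k, by omega⟩ : Fin n).succ = ⟨a + (k.succ : ℕ), by simp; omega⟩ := Fin.ext (by simp; omega)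
    rw [e1, e2]; exact heq
  exact hstatic cls len θ' p' hθ' hdom' hne'

/-- **THE SUPPORT-RESTRICTED STATIC REDUCTION**: `n + 1 ≤ (s·K + 1)·(L + 1)` for every chain of distinct consecutive dominant terms of a design
supported in `Supp` (`≤ s` entries) all of whose static sub-designs have chains `≤ L`. [folklore] -/
theorem chain_succ_le (d : Fin K → ℕ) (v ε : Fin m → Fin m → Fin K → ℤ)
    (Supp : Fin m → Fin m → Prop) (s : ℕ) (hs : ((univ : Finset (Fin m × Fin m)).filter fun e => Supp e.1 e.2).card ≤ s)
    (hsupp : ∀ i j l, ε i j l ≠ 0 → Supp i j) (L : ℕ)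
    (hstatic : ∀ (cls : Fin m → Fin m → Fin K) (n' : ℕ) (θ' : Fin (n' + 1) → ℤ)
      (p' : Fin (n' + 1) → Equiv.Perm (Fin m) × (Fin m → Fin K)), StrictMono θ' →
      (∀ k, IsDominant d v (fun i j l => if l = cls i j then ε i j l else 0) (θ' k) (p' k)) →
      (∀ k : Fin n', p' k.castSucc ≠ p' k.succ) → n' ≤ L)
    (n : ℕ) (θ : Fin (n + 1) → ℤ) (p : Fin (n + 1) → Equiv.Perm (Fin m) × (Fin m → Fin K)) (hθ : StrictMono θ)
    (hdom : ∀ k, IsDominant d v ε (θ k) (p k)) (hne : ∀ k : Fin n, p k.castSucc ≠ p k.succ) :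
    n + 1 ≤ (s * K + 1) * (L + 1) := by
  -- the empty matrix: all terms coincide, so the chain has one term
  rcases Nat.eq_zero_or_pos m with hm0 | hm0
  · subst hm0
    have hn : n = 0 := by
      rcases Nat.eq_zero_or_pos n with h0 | h0
      · exact h0
      · exfalso
        refine hne ⟨0, h0⟩ (Prod.ext (Subsingleton.elim _ _) (funext fun j => Fin.elim0 j))
    subst hn
    nlinarith [Nat.zero_le (s * K), Nat.zero_le L]
  haveI : Nonempty (Fin m) := ⟨⟨0, hm0⟩⟩
  -- incidences (kept opaque) and new indices
  obtain ⟨uses, huses⟩ : ∃ uses : Fin (n + 1) → Fin m → Fin m × Fin m × Fin K,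
      ∀ k j, uses k j = ((p k).1 j, j, (p k).2 j) := ⟨fun k j => ((p k).1 j, j, (p k).2 j), fun _ _ => rfl⟩
  obtain ⟨F, hFmem⟩ : ∃ F : Finset (Fin (n + 1)), ∀ k, k ∈ F ↔ ∃ j, ∀ k' : Fin (n + 1), k' < k → uses k' j ≠ uses k j :=
    ⟨univ.filter fun k => ∃ j, ∀ k' : Fin (n + 1), k' < k → uses k' j ≠ uses k j, fun k => by rw [mem_filter]; simp⟩
  -- (2) |F| ≤ s K
  have hF : F.card ≤ s * K := by
    have hw : ∀ k ∈ F, ∃ j, ∀ k' : Fin (n + 1), k' < k → uses k' j ≠ uses k j := fun k hk => (hFmem k).mp hk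
    choose! w hw using hw
    obtain ⟨B, hBmem⟩ : ∃ B : Finset (Fin m × Fin m × Fin K), ∀ t, t ∈ B ↔ Supp t.1 t.2.1 :=
      ⟨univ.filter fun t => Supp t.1 t.2.1, fun t => by rw [mem_filter]; simp⟩
    have hmaps : ∀ k ∈ F, uses k (w k) ∈ B := by
      intro k hk
      rw [hBmem, huses]
      exact hsupp _ _ _ (LacunarySymmetroidMatrixDescartes.TropicalCensus.present_of_termSign_ne_zero ε (p k) (hdom k).1 (w k))
    have hinj : Set.InjOn (fun k => uses k (w k)) F := by
      intro k hk k' hk' hgk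
      have hg : uses k (w k) = uses k' (w k') := hgk
      have hj : w k = w k' := by
        have h1 := congrArg (fun t => t.2.1) hg
        rw [huses, huses] at h1
        exact h1
      by_contra hkk
      rcases lt_or_gt_of_ne hkk with hlt | hlt
      · refine hw k' hk' k hlt ?_
        rw [← hj] at hg ⊢; exact hg
      · refine hw k hk k' hlt ?_
        rw [← hj] at hg; exact hg.symm
    have h1 : F.card ≤ B.card := card_le_card_of_injOn _ hmaps hinj
    have h2 : B.card ≤ s * K := by
      obtain ⟨Bnd, hBnd⟩ : ∃ Bnd : Finset (Fin m × Fin m), Bnd = univ.filter (fun e => Supp e.1 e.2) := ⟨_, rfl⟩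
      have h3 : B.card ≤ (Bnd ×ˢ (univ : Finset (Fin K))).card := by
        refine card_le_card_of_injOn (fun t => ((t.1, t.2.1), t.2.2)) ?_ ?_
        · intro t ht
          rw [mem_coe, hBmem] at ht
          rw [mem_coe, mem_product, hBnd, mem_filter]
          exact ⟨⟨mem_univ _, ht⟩, mem_univ _⟩
        · intro t _ t' _ h
          simp only [Prod.mk.injEq] at h
          obtain ⟨⟨h1, h2⟩, h3⟩ := h
          exact Prod.ext h1 (Prod.ext h2 h3)
      rw [card_product, card_univ, Fintype.card_fin] at h3
      have h4 : Bnd.card ≤ s := by rw [hBnd]; exact hs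
      calc B.card ≤ _ := h3
        _ ≤ s * K := Nat.mul_le_mul_right _ h4
    exact h1.trans h2
  -- (3) the last new index at or before `k`
  obtain ⟨G, hG⟩ : ∃ G : Finset (Fin (n + 1)), G = insert 0 F := ⟨_, rfl⟩
  have hf : ∀ k : Fin (n + 1), ∃ fk : Fin (n + 1), fk ∈ G ∧ fk ≤ k ∧ ∀ x ∈ G, x ≤ k → x ≤ fk := by
    intro k
    have hne0 : (G.filter fun x => x ≤ k).Nonempty := ⟨0, mem_filter.mpr ⟨by rw [hG]; exact mem_insert_self _ _, Fin.zero_le _⟩⟩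
    refine ⟨(G.filter fun x => x ≤ k).max' hne0, (mem_filter.mp (max'_mem _ hne0)).1, (mem_filter.mp (max'_mem _ hne0)).2,
      fun x hx hxk => le_max' _ _ (mem_filter.mpr ⟨hx, hxk⟩)⟩
  choose f hfG hfle hfmax using hf
  -- first use of an incidence
  have hfirst : ∀ (k₂ : Fin (n + 1)) (j : Fin m), ∃ f₂ : Fin (n + 1), f₂ ≤ k₂ ∧ uses f₂ j = uses k₂ j ∧
      ∀ k' : Fin (n + 1), k' < f₂ → uses k' j ≠ uses k₂ j := by
    intro k₂ j
    obtain ⟨S, hS⟩ : ∃ S : Finset (Fin (n + 1)), ∀ k', k' ∈ S ↔ uses k' j = uses k₂ j :=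
      ⟨univ.filter fun k' => uses k' j = uses k₂ j, fun k' => by rw [mem_filter]; simp⟩
    have hk₂ : k₂ ∈ S := (hS k₂).mpr rfl
    have hSne : S.Nonempty := ⟨k₂, hk₂⟩
    refine ⟨S.min' hSne, min'_le _ _ hk₂, (hS _).mp (min'_mem S hSne), fun k' hk' heq => ?_⟩
    have : S.min' hSne ≤ k' := min'_le _ _ ((hS k').mpr heq)
    exact absurd hk' (not_lt.mpr this)
  -- consistency of `[f k, k]`
  have hcons : ∀ k k₁ k₂ : Fin (n + 1), f k ≤ k₁ → k₁ ≤ k → f k ≤ k₂ → k₂ ≤ k →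
      ∀ j, (p k₁).1 j = (p k₂).1 j → (p k₁).2 j = (p k₂).2 j := by
    -- it suffices to treat `k₁ < k₂`
    suffices H : ∀ k k₁ k₂ : Fin (n + 1), f k ≤ k₁ → k₂ ≤ k → k₁ < k₂ →
        ∀ j, (p k₁).1 j = (p k₂).1 j → (p k₁).2 j = (p k₂).2 j by
      intro k k₁ k₂ h1 h2 h3 h4 j hj
      rcases lt_trichotomy k₁ k₂ with hlt | heq | hgt
      · exact H k k₁ k₂ h1 h4 hlt j hj
      · rw [heq]
      · exact (H k k₂ k₁ h3 h2 hgt j hj.symm).symm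
    intro k k₁ k₂ h1 h4 hlt j hj
    by_contra hcl
    obtain ⟨f₂, hf₂le, hf₂use, hf₂first⟩ := hfirst k₂ j
    -- `f₂` is new, hence `f₂ ≤ f k`
    have hf₂G : f₂ ∈ G := by
      rw [hG]
      refine mem_insert_of_mem ((hFmem f₂).mpr ⟨j, fun k' hk' => ?_⟩)
      rw [hf₂use]; exact hf₂first k' hk'
    have hf₂k : f₂ ≤ f k := hfmax k f₂ hf₂G (hf₂le.trans h4)
    -- the uses `f₂ < k₁ < k₂` of the entry carry the classes `l₂, l₁, l₂`: a return
    rw [huses, huses] at hf₂use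
    have hrow₂ : (p f₂).1 j = (p k₂).1 j := by have := congrArg Prod.fst hf₂use; exact this
    have hcls₂ : (p f₂).2 j = (p k₂).2 j := by have := congrArg (fun t => t.2.2) hf₂use; exact this
    have hf₂lt : f₂ < k₁ := by
      rcases lt_or_eq_of_le (hf₂k.trans h1) with h | h
      · exact h
      · exfalso; apply hcl; rw [← h, hcls₂]
    have := class_noReturn d v ε θ p hθ hdom hf₂lt hlt j (hrow₂.trans hj.symm) hj hcls₂
    exact hcl (this.trans hcls₂)
  -- (4) offsets are at most `L`
  have hoff : ∀ k : Fin (n + 1), (k : ℕ) - (f k : ℕ) ≤ L := by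
    intro k
    have hfk := hfle k
    rw [Fin.le_def] at hfk
    exact interval_le d v ε L hstatic θ p hθ hdom hne (f k) ((k : ℕ) - (f k : ℕ)) (by have := k.isLt; omega)
      (fun k₁ k₂ h1 h2 h3 h4 j hj => hcons k k₁ k₂ h1 (by rw [Fin.le_def]; omega) h3 (by rw [Fin.le_def]; omega) j hj)
  -- the injection `k ↦ (f k, k − f k)`
  have hι : Set.InjOn (fun k : Fin (n + 1) => (f k, (k : ℕ) - (f k : ℕ))) (univ : Finset (Fin (n + 1))) := by
    intro k _ k' _ h
    simp only [Prod.mk.injEq] at h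
    obtain ⟨h1, h2⟩ := h
    have e1 := hfle k; have e2 := hfle k'
    rw [Fin.le_def] at e1 e2
    apply Fin.ext
    have : (f k : ℕ) = (f k' : ℕ) := by rw [h1]
    omega
  have hmaps : ∀ k ∈ (univ : Finset (Fin (n + 1))), (fun k : Fin (n + 1) => (f k, (k : ℕ) - (f k : ℕ))) k ∈ G ×ˢ range (L + 1) :=
    fun k _ => mem_product.mpr ⟨hfG k, mem_range.mpr (Nat.lt_succ_of_le (hoff k))⟩
  have h1 := card_le_card_of_injOn _ hmaps hι
  rw [card_univ, Fintype.card_fin, card_product, card_range] at h1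
  have h2 : G.card ≤ s * K + 1 := by rw [hG]; exact (card_insert_le _ _).trans (by omega)
  calc n + 1 ≤ G.card * (L + 1) := h1
    _ ≤ (s * K + 1) * (L + 1) := Nat.mul_le_mul_right _ h2

end StaticReduction

end Summit.ValiantsHypothesis.ValiantsHypothesis.Theorems.KPlusLogSqLaw
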